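import Literature.AlgebraicGeometry.Motives.MixedHodgeExtensionYonedaExtTwo
import Literature.AlgebraicGeometry.Motives.MixedHodgeExtensionBiproduct
import HarnessLib

/-!
# Three-step mixed Hodge structures: the fillings of a two-fold extension form a torsor

Hain, *Periods of real biextensions* (2024), §2 "Moduli of biextensions": for Hodge structures `B`, `C`
(of weights `-1`, `-2`) and `A = A(0)`, the set `𝓑_A(B, C)` of framed biextensions — mixed Hodge
structures `V` with `W₀V = V`, `W₋₃V = 0` and framings `A ≅ Gr^W_0 V`, `B ≅ Gr^W_{-1} V`,
`C ≅ Gr^W_{-2} V` — has "a canonical base point, namely the split biextension `V₀ := A ⊕ B ⊕ C`", and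
"The projection `𝓑_A(B, C) → Ext¹_MHS(A, B) × Ext¹_MHS(B, C)` defined by `V ↦ (V/W₋₂, W₋₁V)` is an
`Ext¹_MHS(A, C)` torsor. (See [hain-zucker].)" The mechanism is the contravariant long exact sequence
of `Ext_MHS(·, C)` along `0 → K → E₂ → A → 0` (Mac Lane, *Homology*, Ch. III Thm. 3.2), which the
tree has for ALL pairs of mixed `ℚ`-Hodge structures (`MixedHodgeExtensionNonSeparatedExact.lean`:
`Ext.pullbackMapW_inc_eq_zeroW_iff`, `Ext.pullbackMapW_proj_eq_zeroW_iff`, and the right exactness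
`Ext.pullbackMapW_surjective_of_injective`, Brylinski–Zucker Prop. 5.22: `Ext² = 0`).

In the tree's language a three-step mixed Hodge structure `B ⊆ E₁ ⊆ H` over the pair
(`e₁ : 0 → B → E₁ → K → 0`, `e₂ : 0 → K → E₂ → A → 0`) is a **filling** of the Yoneda composite
`e₁ ∘ e₂` (`MixedHodgeExtensionYonedaExtTwo.lean`: `TwoExtension.Filling` — an extension
`0 → B → H → E₂ → 0` with a lift `E₁ → H` of `E₁ → E₂` restricting to `B ↪ H`). This file proves, for
ARBITRARY mixed `ℚ`-Hodge structures `A`, `B`, `K` (no purity, no separation):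

* §0 `Hom.eq_zero_of_isSeparated` — a morphism from `K` to `B` vanishes when all weights of `B` lie
  below all weights of `K` (strictness, Deligne II Thm. 2.3.5).
* §1 for an extension `e₂ : 0 → K —ι→ E₂ —π→ A → 0` and a class `y ∈ Ext¹(K, B)`: the fibre
  `e₂.restrictionFibre y = {c ∈ Ext¹(E₂, B) | ι^* c = y}` is non-empty (`Ext² = 0`), stable under
  `c ↦ c + π^* x` for `x ∈ Ext¹(A, B)`, any two members differ by some `π^* x` (exactness at
  `Ext¹(E₂, B)`), and `c + π^* x = c` iff `x = g_* [e₂]` for a morphism `g : K → B` (exactness at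
  `Ext¹(A, B)`): **the fibre is a torsor under `Ext¹(A, B)/δ Hom(K, B)`**, a free `Ext¹(A, B)`-torsor
  when `Hom_MHS(K, B) = 0`, e.g. for `(K, B)` separated (`pullbackMapW_proj_injective_of_isSeparated`).
* §2 for a two-fold extension `E : 0 → B → E₁ → E₂ → A → 0`: the classes `[Φ.ext] ∈ Ext¹(E₂, B)` of its
  fillings are exactly the fibre over `[E.factor₁] ∈ Ext¹(K, B)`, `K = Im(E₁ → E₂)`
  (`fillingClasses_eq_range`); hence any two fillings differ by a unique-up-to-`δ Hom(K, B)` element of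
  `Ext¹(A, B)` and every translate is again realized by a filling (`Filling.exists_eq_addW_pullbackMapW`,
  `Filling.exists_filling_eq_addW`, `Filling.addW_pullbackMapW_eq_iff`).
* §3 Hain's form: for extensions `e₁` of `K` by `B` and `e₂` of `A` by `K`, the three-step mixed Hodge
  structures `H` with `W`-sub-extension `e₁` and quotient extension `e₂` — fillings of `e₁ ∘ e₂` — have
  classes sweeping out the fibre of `ι^*` over `[e₁]` (`spliceFillingOfCongruence`,
  `fillingClasses_splice`), an `Ext¹(A, B)`-torsor in the above sense (`Filling.exists_eq_addW_of_splice`,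
  free for separated `(K, B)`: `Filling.eq_of_splice_of_isSeparated`).

All statements proved; no named facts. Hain's integral / real refinements (`A`-MHS for a subring
`A ⊆ ℝ`, the complex structure on `𝓑`) are not treated: `ℚ`-MHS only.

## References

* [Hain2024PeriodsRealBiextensions] R. Hain, Periods of real biextensions, arXiv:2408.13997 (2024), §2
  (the torsor `𝓑_A(B, C) → Ext¹(A, B) × Ext¹(B, C)`; held text `paper:arxiv-2408.13997`, p. 5).
* [MacLane1963Homology] S. Mac Lane, Homology (1963), Ch. III Thm. 3.2 (exactness of
  `Hom(K, B) → Ext(A, B) → Ext(E₂, B) → Ext(K, B)`), §5 (Yoneda composites).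
* [BrylinskiZucker1998] J.-L. Brylinski, S. Zucker, An overview of recent advances in Hodge theory,
  Prop. 5.22 and its corollary `Ext² = 0`.
* [DeligneHodgeII1971] P. Deligne, Théorie de Hodge II, Thm. 2.3.5 (iii) (strictness).
-/

open scoped TensorProduct

noncomputable section

namespace Literature.AlgebraicGeometry.Motives

namespace MixedHodgeStructure

variable {VA : Type*} [AddCommGroup VA] [Module ℚ VA]
variable {VB : Type*} [AddCommGroup VB] [Module ℚ VB]
variable {VK : Type*} [AddCommGroup VK] [Module ℚ VK]
variable {V₁ : Type*} [AddCommGroup V₁] [Module ℚ V₁]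
variable {V₂ : Type*} [AddCommGroup V₂] [Module ℚ V₂]
variable {VH : Type*} [AddCommGroup VH] [Module ℚ VH]
variable {VH' : Type*} [AddCommGroup VH'] [Module ℚ VH']
variable {A : MixedHodgeStructure VA} {B : MixedHodgeStructure VB} {K : MixedHodgeStructure VK}

/-! ### §0 Morphisms against the separation vanish -/

/-- **`Hom_MHS(K, B) = 0` for a separated pair** (all weights of `B` at most `m`, all weights of `K`
above `m`): a morphism `f : K → B` is strict (Deligne II, Thm. 2.3.5 (iii)), so
`f(K) ∩ W_m B = f(W_m K) = 0`, and `W_m B = B`. [cite: DeligneHodgeII1971, Thm. 2.3.5] -/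
theorem Hom.eq_zero_of_isSeparated (hsep : IsSeparated K B) (f : Hom K B) : f = Hom.zero K B := by
  obtain ⟨m, hB, hK⟩ := hsep
  have h := (Hom.strict_holds f).map_W m
  rw [hK, Submodule.map_bot, hB, top_inf_eq] at h
  refine Hom.ext (LinearMap.ext fun x => ?_)
  have hx : f.toLinearMap x ∈ LinearMap.range f.toLinearMap := LinearMap.mem_range_self _ x
  rw [← h, Submodule.mem_bot] at hx
  exact hx

/-! ### §1 The fibre of `ι^* : Ext¹(E₂, B) → Ext¹(K, B)` is a torsor under `Ext¹(A, B)/δ Hom(K, B)` -/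

namespace Ext

/-- `x + 0 = x` in `Ext(A, B)`. [cite: Carlson1980, §2(b) Prop. 1] -/
theorem addW_zeroW (x : Ext A B) : addW x zeroW = x := by
  rw [addW_comm, zeroW_addW]

/-- `x + (-x) = 0` in `Ext(A, B)`. [cite: Carlson1980, §2(b) Prop. 1] -/
theorem addW_negW_cancel (x : Ext A B) : addW x (negW x) = zeroW := by
  rw [addW_comm, negW_addW_cancel]

/-- Cancellation: `x + t = x ↔ t = 0` in `Ext(A, B)`. [cite: Carlson1980, §2(b) Prop. 1] -/
theorem addW_eq_self_iff (x t : Ext A B) : addW x t = x ↔ t = zeroW := by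
  constructor
  · intro h
    have h' := congrArg (addW (negW x)) h
    rwa [← addW_assoc, negW_addW_cancel, zeroW_addW] at h'
  · rintro rfl
    exact addW_zeroW x

/-- `x - x' = 0 → x = x'` in `Ext(A, B)`. [cite: Carlson1980, §2(b) Prop. 1] -/
theorem eq_of_addW_negW_eq_zeroW {x x' : Ext A B} (h : addW x (negW x') = zeroW) : x = x' := by
  have h' : addW (addW x (negW x')) x' = addW zeroW x' := by rw [h]
  rwa [addW_assoc, negW_addW_cancel, addW_zeroW, zeroW_addW] at h'

/-- Left cancellation: `x + t = x + t' → t = t'` in `Ext(A, B)`. [cite: Carlson1980, §2(b) Prop. 1] -/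
theorem addW_left_cancel {x t t' : Ext A B} (h : addW x t = addW x t') : t = t' := by
  have h' := congrArg (addW (negW x)) h
  rwa [← addW_assoc, ← addW_assoc, negW_addW_cancel, zeroW_addW, zeroW_addW] at h'

end Ext

namespace Extension

variable (e₂ : Extension A K V₂)

/-- **The fibre of `ι^* : Ext¹(E₂, B) → Ext¹(K, B)` over a class `y`**, for an extension
`e₂ : 0 → K —ι→ E₂ —π→ A → 0`: the classes of extensions `H` of `E₂` by `B` restricting to `y` on `K`.
For `y = [e₁]` these are the three-step mixed Hodge structures `B ⊆ E₁ ⊆ H` over `(e₁, e₂)` (§3),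
Hain's fibre of `𝓑 → Ext¹ × Ext¹`. [cite: Hain2024PeriodsRealBiextensions, §2] -/
def restrictionFibre (y : Ext K B) : Set (Ext e₂.mhs B) :=
  {c | Ext.pullbackMapW e₂.inc c = y}

/-- Membership in the fibre: `ι^* c = y`. [cite: Hain2024PeriodsRealBiextensions, §2] -/
theorem mem_restrictionFibre_iff (y : Ext K B) (c : Ext e₂.mhs B) :
    c ∈ e₂.restrictionFibre y ↔ Ext.pullbackMapW e₂.inc c = y :=
  Iff.rfl

/-- **The fibre is non-empty** — `ι^*` is onto along the injection `ι : K ↪ E₂` (Brylinski–Zucker: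
`Ext²_MHS = 0`). [cite: BrylinskiZucker1998, Prop. 5.22] -/
theorem restrictionFibre_nonempty (y : Ext K B) : (e₂.restrictionFibre y).Nonempty :=
  Ext.pullbackMapW_surjective_of_injective e₂.inc e₂.injective_inc y

/-- **`Ext¹(A, B)` acts on the fibre** by `c ↦ c + π^* x` (`ι^* π^* = 0`).
[cite: MacLane1963Homology, Ch. III Thm. 3.2] -/
theorem addW_pullbackMapW_proj_mem_restrictionFibre {y : Ext K B} {c : Ext e₂.mhs B}
    (hc : c ∈ e₂.restrictionFibre y) (x : Ext A B) :
    Ext.addW c (Ext.pullbackMapW e₂.proj x) ∈ e₂.restrictionFibre y := by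
  rw [mem_restrictionFibre_iff] at hc ⊢
  rw [Ext.pullbackMapW_addW, hc, Ext.pullbackMapW_inc_pullbackMapW_proj, Ext.addW_zeroW]

/-- **The action is transitive on the fibre**: two classes with the same restriction to `K` differ by
`π^* x` for some `x ∈ Ext¹(A, B)` (exactness of `Ext(A, B) —π^*→ Ext(E₂, B) —ι^*→ Ext(K, B)`, Mac Lane
III Thm. 3.2, all pairs). [cite: MacLane1963Homology, Ch. III Thm. 3.2] [cite: Hain2024PeriodsRealBiextensions, §2] -/
theorem exists_eq_addW_pullbackMapW_proj {y : Ext K B} {c c' : Ext e₂.mhs B}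
    (hc : c ∈ e₂.restrictionFibre y) (hc' : c' ∈ e₂.restrictionFibre y) :
    ∃ x : Ext A B, c' = Ext.addW c (Ext.pullbackMapW e₂.proj x) := by
  rw [mem_restrictionFibre_iff] at hc hc'
  have h0 : Ext.pullbackMapW e₂.inc (Ext.addW c' (Ext.negW c)) = Ext.zeroW := by
    rw [Ext.pullbackMapW_addW, Ext.pullbackMapW_negW, hc, hc', Ext.addW_negW_cancel]
  obtain ⟨x, hx⟩ := (Ext.pullbackMapW_inc_eq_zeroW_iff e₂ _).1 h0
  refine ⟨x, ?_⟩
  rw [← hx, Ext.addW_comm c, Ext.addW_assoc, Ext.negW_addW_cancel, Ext.addW_zeroW]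

/-- **The stabilizer is `δ Hom(K, B)`**: `c + π^* x = c` iff `x = g_* [e₂]` for some morphism
`g : K → B` (exactness of `Hom(K, B) —δ→ Ext(A, B) —π^*→ Ext(E₂, B)`, Mac Lane III Thm. 3.2).
[cite: MacLane1963Homology, Ch. III Thm. 3.2] -/
theorem addW_pullbackMapW_proj_eq_self_iff (c : Ext e₂.mhs B) (x : Ext A B) :
    Ext.addW c (Ext.pullbackMapW e₂.proj x) = c ↔ ∃ g : Hom K B, x = Ext.pushoutMapW g (Ext.mkOfW e₂) := by
  rw [Ext.addW_eq_self_iff, Ext.pullbackMapW_proj_eq_zeroW_iff]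

/-- Two translates agree iff the parameters differ by an element of `δ Hom(K, B)`:
`c + π^* x = c + π^* x' ↔ x - x' = g_* [e₂]` for some `g : K → B`. [cite: MacLane1963Homology, Ch. III Thm. 3.2] -/
theorem addW_pullbackMapW_proj_eq_iff (c : Ext e₂.mhs B) (x x' : Ext A B) :
    Ext.addW c (Ext.pullbackMapW e₂.proj x) = Ext.addW c (Ext.pullbackMapW e₂.proj x') ↔
      ∃ g : Hom K B, Ext.addW x (Ext.negW x') = Ext.pushoutMapW g (Ext.mkOfW e₂) := by
  rw [← Ext.pullbackMapW_proj_eq_zeroW_iff, Ext.pullbackMapW_addW, Ext.pullbackMapW_negW]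
  constructor
  · intro h
    rw [Ext.addW_left_cancel h, Ext.addW_negW_cancel]
  · intro h
    rw [Ext.eq_of_addW_negW_eq_zeroW h]

/-- **The action is free when `Hom_MHS(K, B) = 0`**: `π^* : Ext¹(A, B) → Ext¹(E₂, B)` is injective.
[cite: MacLane1963Homology, Ch. III Thm. 3.2] [cite: Hain2024PeriodsRealBiextensions, §2] -/
theorem pullbackMapW_proj_injective_of_hom_eq_zero (h : ∀ g : Hom K B, g = Hom.zero K B) :
    Function.Injective (Ext.pullbackMapW e₂.proj : Ext A B → Ext e₂.mhs B) := by
  intro x x' hxx'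
  have h0 : Ext.pullbackMapW e₂.proj (Ext.addW x (Ext.negW x')) = Ext.zeroW := by
    rw [Ext.pullbackMapW_addW, Ext.pullbackMapW_negW, hxx', Ext.addW_negW_cancel]
  obtain ⟨g, hg⟩ := (Ext.pullbackMapW_proj_eq_zeroW_iff e₂ _).1 h0
  rw [h g, Ext.pushoutMapW_zero] at hg
  exact Ext.eq_of_addW_negW_eq_zeroW hg

/-- **Free for separated `(K, B)`** (all weights of `B` below all weights of `K`, as for Hain's pure
`B`, `C` of weights `-1`, `-2`): `π^*` is injective, so the fibre is an `Ext¹(A, B)`-torsor.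
[cite: Hain2024PeriodsRealBiextensions, §2] -/
theorem pullbackMapW_proj_injective_of_isSeparated (hsep : IsSeparated K B) :
    Function.Injective (Ext.pullbackMapW e₂.proj : Ext A B → Ext e₂.mhs B) :=
  e₂.pullbackMapW_proj_injective_of_hom_eq_zero (Hom.eq_zero_of_isSeparated hsep)

/-- Uniqueness of the parameter when `Hom_MHS(K, B) = 0`: `c + π^* x = c + π^* x' → x = x'`.
[cite: Hain2024PeriodsRealBiextensions, §2] -/
theorem eq_of_addW_pullbackMapW_proj_eq (h : ∀ g : Hom K B, g = Hom.zero K B) {c : Ext e₂.mhs B}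
    {x x' : Ext A B}
    (hxx' : Ext.addW c (Ext.pullbackMapW e₂.proj x) = Ext.addW c (Ext.pullbackMapW e₂.proj x')) : x = x' :=
  e₂.pullbackMapW_proj_injective_of_hom_eq_zero h (Ext.addW_left_cancel hxx')

/-- **The fibre is the orbit of any of its points**: `{c' | ι^* c' = y} = {c + π^* x | x ∈ Ext¹(A, B)}`.
[cite: Hain2024PeriodsRealBiextensions, §2] [cite: MacLane1963Homology, Ch. III Thm. 3.2] -/
theorem restrictionFibre_eq_range {y : Ext K B} {c : Ext e₂.mhs B} (hc : c ∈ e₂.restrictionFibre y) :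
    e₂.restrictionFibre y = Set.range fun x : Ext A B => Ext.addW c (Ext.pullbackMapW e₂.proj x) := by
  ext c'
  constructor
  · intro hc'
    obtain ⟨x, rfl⟩ := e₂.exists_eq_addW_pullbackMapW_proj hc hc'
    exact ⟨x, rfl⟩
  · rintro ⟨x, rfl⟩
    exact e₂.addW_pullbackMapW_proj_mem_restrictionFibre hc x

end Extension

/-! ### §2 The fillings of a two-fold extension -/

namespace TwoExtension

variable (E : TwoExtension A B V₁ V₂)

/-- **The classes of the fillings of `E`**: the fibre of `ι^* : Ext¹(E₂, B) → Ext¹(K, B)` over the class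
of the first factor `E.factor₁ : 0 → B → E₁ → K → 0`, `K = Im(E₁ → E₂)`, `ι : K ↪ E₂`
(`= E.factor₂.restrictionFibre [E.factor₁]`). [cite: Hain2024PeriodsRealBiextensions, §2] -/
def fillingClasses : Set (Ext E.mhs₂ B) :=
  E.factor₂.restrictionFibre (Ext.mkOfW E.factor₁)

/-- Membership: `ι^* c = [E.factor₁]`. [cite: Hain2024PeriodsRealBiextensions, §2] -/
theorem mem_fillingClasses_iff (c : Ext E.mhs₂ B) :
    c ∈ E.fillingClasses ↔ Ext.pullbackMapW E.image.subtype c = Ext.mkOfW E.factor₁ :=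
  Iff.rfl

/-- **The class of a filling restricts to the first factor**: `ι^* [Φ.ext] = [E.factor₁]`.
[cite: MacLane1963Homology, Ch. III §5 Prop. 5.1] -/
theorem Filling.pullbackMapW_subtype_mkOfW (Φ : E.Filling VH) :
    Ext.pullbackMapW E.image.subtype (Ext.mkOfW Φ.ext) = Ext.mkOfW E.factor₁ := by
  rw [Ext.pullbackMapW_mkOfW]
  exact (Ext.mkOfW_eq_of_congruence (Classical.choice Φ.nonempty_congruence_pullback_factor₁)).symm

/-- The class of a filling lies in `fillingClasses`. [cite: Hain2024PeriodsRealBiextensions, §2] -/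
theorem Filling.mkOfW_mem_fillingClasses (Φ : E.Filling VH) : Ext.mkOfW Φ.ext ∈ E.fillingClasses :=
  Filling.pullbackMapW_subtype_mkOfW E Φ

/-- **Every class in the fibre is the class of a filling** (on the carrier `V₂ × VB`).
[cite: Hain2024PeriodsRealBiextensions, §2] -/
theorem exists_filling_of_mem_fillingClasses {c : Ext E.mhs₂ B} (hc : c ∈ E.fillingClasses) :
    ∃ Φ : E.Filling (V₂ × VB), Ext.mkOfW Φ.ext = c := by
  obtain ⟨H, rfl⟩ := Ext.exists_mkOfW_eq c
  rw [mem_fillingClasses_iff, Ext.pullbackMapW_mkOfW, Ext.mkOfW_eq_mkOfW_iff] at hc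
  exact ⟨E.fillingOfCongruence H (Classical.choice hc), rfl⟩

/-- **`fillingClasses` is the set of classes of fillings.** [cite: Hain2024PeriodsRealBiextensions, §2] -/
theorem fillingClasses_eq_range :
    E.fillingClasses = Set.range fun Φ : E.Filling (V₂ × VB) => Ext.mkOfW Φ.ext := by
  ext c
  constructor
  · intro hc
    obtain ⟨Φ, hΦ⟩ := E.exists_filling_of_mem_fillingClasses hc
    exact ⟨Φ, hΦ⟩
  · rintro ⟨Φ, rfl⟩
    exact Filling.mkOfW_mem_fillingClasses E Φ

/-- `fillingClasses` is non-empty. [cite: BrylinskiZucker1998, Prop. 5.22] -/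
theorem fillingClasses_nonempty : E.fillingClasses.Nonempty :=
  ⟨_, Filling.mkOfW_mem_fillingClasses E (Classical.choice E.nonempty_filling)⟩

/-- Two fillings are congruent as extensions of `E₂` by `B` iff they have the same class.
[cite: BrylinskiZucker1998, Prop. 5.22] -/
theorem Filling.nonempty_congruence_iff (Φ : E.Filling VH) (Φ' : E.Filling VH') :
    Nonempty (Extension.Congruence Φ.ext Φ'.ext) ↔ Ext.mkOfW Φ.ext = Ext.mkOfW Φ'.ext :=
  (Ext.mkOfW_eq_mkOfW_iff _ _).symm

/-- **Any two fillings of `E` differ by an element of `Ext¹(A, B)`**: `[Φ'.ext] = [Φ.ext] + π^* x`.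
[cite: Hain2024PeriodsRealBiextensions, §2] [cite: MacLane1963Homology, Ch. III Thm. 3.2] -/
theorem Filling.exists_eq_addW_pullbackMapW (Φ : E.Filling VH) (Φ' : E.Filling VH') :
    ∃ x : Ext A B, Ext.mkOfW Φ'.ext = Ext.addW (Ext.mkOfW Φ.ext) (Ext.pullbackMapW E.proj x) :=
  E.factor₂.exists_eq_addW_pullbackMapW_proj (Filling.mkOfW_mem_fillingClasses E Φ)
    (Filling.mkOfW_mem_fillingClasses E Φ')

/-- **Every translate `[Φ.ext] + π^* x` is the class of a filling.** [cite: Hain2024PeriodsRealBiextensions, §2] -/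
theorem Filling.exists_filling_eq_addW (Φ : E.Filling VH) (x : Ext A B) :
    ∃ Φ' : E.Filling (V₂ × VB), Ext.mkOfW Φ'.ext = Ext.addW (Ext.mkOfW Φ.ext) (Ext.pullbackMapW E.proj x) :=
  E.exists_filling_of_mem_fillingClasses
    (E.factor₂.addW_pullbackMapW_proj_mem_restrictionFibre (Filling.mkOfW_mem_fillingClasses E Φ) x)

/-- **The stabilizer of a filling class is `δ Hom(K, B)`**: `[Φ.ext] + π^* x = [Φ.ext]` iff
`x = g_* [E.factor₂]` for a morphism `g : K → B`. [cite: MacLane1963Homology, Ch. III Thm. 3.2] -/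
theorem Filling.addW_pullbackMapW_eq_self_iff (Φ : E.Filling VH) (x : Ext A B) :
    Ext.addW (Ext.mkOfW Φ.ext) (Ext.pullbackMapW E.proj x) = Ext.mkOfW Φ.ext ↔
      ∃ g : Hom E.image.toMixedHodgeStructure B, x = Ext.pushoutMapW g (Ext.mkOfW E.factor₂) :=
  E.factor₂.addW_pullbackMapW_proj_eq_self_iff _ x

/-- `[Φ.ext] + π^* x = [Φ.ext] + π^* x'` iff `x - x' ∈ δ Hom(K, B)`. [cite: MacLane1963Homology, Ch. III Thm. 3.2] -/
theorem Filling.addW_pullbackMapW_eq_iff (Φ : E.Filling VH) (x x' : Ext A B) :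
    Ext.addW (Ext.mkOfW Φ.ext) (Ext.pullbackMapW E.proj x) = Ext.addW (Ext.mkOfW Φ.ext) (Ext.pullbackMapW E.proj x') ↔
      ∃ g : Hom E.image.toMixedHodgeStructure B, Ext.addW x (Ext.negW x') = Ext.pushoutMapW g (Ext.mkOfW E.factor₂) :=
  E.factor₂.addW_pullbackMapW_proj_eq_iff _ x x'

/-- **The set of filling classes is the `Ext¹(A, B)`-orbit of any filling class.**
[cite: Hain2024PeriodsRealBiextensions, §2] -/
theorem fillingClasses_eq_orbit (Φ : E.Filling VH) :
    E.fillingClasses = Set.range fun x : Ext A B => Ext.addW (Ext.mkOfW Φ.ext) (Ext.pullbackMapW E.proj x) :=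
  E.factor₂.restrictionFibre_eq_range (Filling.mkOfW_mem_fillingClasses E Φ)

end TwoExtension

/-! ### §3 Hain's form: three-step mixed Hodge structures over `(e₁, e₂)` -/

namespace TwoExtension

variable (e₁ : Extension K B V₁) (e₂ : Extension A K V₂)

/-- **A filling of `e₁ ∘ e₂` restricts to `e₁` on `K`**: `ι^* [Φ.ext] = [e₁]` — the morphism
`(1_B, u, ι) : e₁ → Φ.ext` factors through `ι^* Φ.ext` (Mac Lane III Lemma 1.3).
[cite: MacLane1963Homology, Ch. III §5 Prop. 5.1] -/
def Filling.spliceMorphism (Φ : (splice e₁ e₂).Filling VH) : Extension.Morphism e₁ Φ.ext where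
  left := Hom.id B
  mid := Φ.lift
  right := e₂.inc
  mid_inc := by
    rw [Hom.id_toLinearMap, LinearMap.comp_id]
    exact congrArg Hom.toLinearMap Φ.lift_comp_inc
  proj_mid := congrArg Hom.toLinearMap Φ.proj_comp_lift

/-- Ends of `spliceMorphism` (by `rfl`). [cite: MacLane1963Homology, Ch. III §5 Prop. 5.1] -/
@[simp] theorem Filling.spliceMorphism_right (Φ : (splice e₁ e₂).Filling VH) :
    (Filling.spliceMorphism e₁ e₂ Φ).right = e₂.inc := rfl

/-- `ι^* Φ.ext ≡ e₁` for a filling of `e₁ ∘ e₂`. [cite: MacLane1963Homology, Ch. III Lemma 1.3] -/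
theorem Filling.nonempty_congruence_pullback_of_splice (Φ : (splice e₁ e₂).Filling VH) :
    Nonempty (Extension.Congruence e₁ (Φ.ext.pullback e₂.inc)) :=
  ⟨(Filling.spliceMorphism e₁ e₂ Φ).congruencePullback rfl⟩

/-- `ι^* [Φ.ext] = [e₁]` for a filling of `e₁ ∘ e₂`. [cite: Hain2024PeriodsRealBiextensions, §2] -/
theorem Filling.pullbackMapW_inc_mkOfW_of_splice (Φ : (splice e₁ e₂).Filling VH) :
    Ext.pullbackMapW e₂.inc (Ext.mkOfW Φ.ext) = Ext.mkOfW e₁ := by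
  rw [Ext.pullbackMapW_mkOfW]
  exact (Ext.mkOfW_eq_of_congruence
    (Classical.choice (Filling.nonempty_congruence_pullback_of_splice e₁ e₂ Φ))).symm

/-- **A three-step structure from an extension of `E₂` by `B` restricting to `e₁`**: if `ι^* H ≡ e₁`
then `E₁ ≅ ι^* H → H` fills `e₁ ∘ e₂`. [cite: Hain2024PeriodsRealBiextensions, §2] -/
def spliceFillingOfCongruence (H : Extension e₂.mhs B VH) (c : Extension.Congruence (H.pullback e₂.inc) e₁) :
    (splice e₁ e₂).Filling VH where
  ext := H
  lift := (H.pullbackFst e₂.inc).comp c.inv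
  lift_comp_inc := by
    refine Hom.ext ?_
    rw [Hom.comp_toLinearMap, Hom.comp_toLinearMap, LinearMap.comp_assoc]
    rw [splice_inc, c.inv_inc]
    exact (H.pullbackMorphism e₂.inc).mid_inc.trans (LinearMap.comp_id _)
  proj_comp_lift := by
    refine Hom.ext (LinearMap.ext fun x => ?_)
    have h2 := LinearMap.congr_fun c.proj_inv x
    rw [LinearMap.comp_apply] at h2
    calc H.proj.toLinearMap ((H.pullbackFst e₂.inc).toLinearMap (c.inv.toLinearMap x))
        = e₂.inc.toLinearMap ((H.pullback e₂.inc).proj.toLinearMap (c.inv.toLinearMap x)) :=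
          H.proj_fst_eq e₂.inc _
      _ = e₂.inc.toLinearMap (e₁.proj.toLinearMap x) := by rw [h2]
      _ = (splice e₁ e₂).mid.toLinearMap x := rfl

/-- The extension of `spliceFillingOfCongruence` is `H` (by `rfl`). [cite: Hain2024PeriodsRealBiextensions, §2] -/
@[simp] theorem spliceFillingOfCongruence_ext (H : Extension e₂.mhs B VH)
    (c : Extension.Congruence (H.pullback e₂.inc) e₁) : (spliceFillingOfCongruence e₁ e₂ H c).ext = H := rfl

/-- **Every class restricting to `[e₁]` is the class of a three-step structure over `(e₁, e₂)`.**
[cite: Hain2024PeriodsRealBiextensions, §2] -/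
theorem exists_filling_splice_of_mem {c : Ext e₂.mhs B} (hc : c ∈ e₂.restrictionFibre (Ext.mkOfW e₁)) :
    ∃ Φ : (splice e₁ e₂).Filling (V₂ × VB), Ext.mkOfW Φ.ext = c := by
  obtain ⟨H, rfl⟩ := Ext.exists_mkOfW_eq c
  rw [Extension.mem_restrictionFibre_iff, Ext.pullbackMapW_mkOfW, Ext.mkOfW_eq_mkOfW_iff] at hc
  exact ⟨spliceFillingOfCongruence e₁ e₂ H (Classical.choice hc), rfl⟩

/-- **The classes of three-step structures over `(e₁, e₂)` form the fibre of `ι^*` over `[e₁]`**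
(Hain's fibre of `𝓑 → Ext¹(A, K) × Ext¹(K, B)` over `(e₂, e₁)`). [cite: Hain2024PeriodsRealBiextensions, §2] -/
theorem fillingClasses_splice :
    (Set.range fun Φ : (splice e₁ e₂).Filling (V₂ × VB) => Ext.mkOfW Φ.ext) =
      e₂.restrictionFibre (Ext.mkOfW e₁) := by
  ext c
  constructor
  · rintro ⟨Φ, rfl⟩
    exact Filling.pullbackMapW_inc_mkOfW_of_splice e₁ e₂ Φ
  · intro hc
    obtain ⟨Φ, hΦ⟩ := exists_filling_splice_of_mem e₁ e₂ hc
    exact ⟨Φ, hΦ⟩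

/-- **Three-step structures over `(e₁, e₂)` exist** (`Ext²_MHS = 0`). [cite: BrylinskiZucker1998, Prop. 5.22] -/
theorem nonempty_filling_splice : Nonempty ((splice e₁ e₂).Filling (V₂ × VB)) :=
  (splice e₁ e₂).nonempty_filling

/-- **Hain's torsor, transitivity**: any two three-step structures over `(e₁, e₂)` differ by `π^* x` for
some `x ∈ Ext¹(A, B)`. [cite: Hain2024PeriodsRealBiextensions, §2] -/
theorem Filling.exists_eq_addW_of_splice (Φ : (splice e₁ e₂).Filling VH) (Φ' : (splice e₁ e₂).Filling VH') :
    ∃ x : Ext A B, Ext.mkOfW Φ'.ext = Ext.addW (Ext.mkOfW Φ.ext) (Ext.pullbackMapW e₂.proj x) :=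
  e₂.exists_eq_addW_pullbackMapW_proj (Filling.pullbackMapW_inc_mkOfW_of_splice e₁ e₂ Φ)
    (Filling.pullbackMapW_inc_mkOfW_of_splice e₁ e₂ Φ')

/-- **Hain's torsor, the action**: every translate `[Φ.ext] + π^* x` is realized by a three-step
structure over `(e₁, e₂)`. [cite: Hain2024PeriodsRealBiextensions, §2] -/
theorem Filling.exists_filling_eq_addW_of_splice (Φ : (splice e₁ e₂).Filling VH) (x : Ext A B) :
    ∃ Φ' : (splice e₁ e₂).Filling (V₂ × VB),
      Ext.mkOfW Φ'.ext = Ext.addW (Ext.mkOfW Φ.ext) (Ext.pullbackMapW e₂.proj x) :=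
  exists_filling_splice_of_mem e₁ e₂
    (e₂.addW_pullbackMapW_proj_mem_restrictionFibre (Filling.pullbackMapW_inc_mkOfW_of_splice e₁ e₂ Φ) x)

/-- **Hain's torsor, the stabilizer**: `[Φ.ext] + π^* x = [Φ.ext]` iff `x ∈ δ Hom(K, B)`.
[cite: MacLane1963Homology, Ch. III Thm. 3.2] -/
theorem Filling.addW_eq_self_iff_of_splice (Φ : (splice e₁ e₂).Filling VH) (x : Ext A B) :
    Ext.addW (Ext.mkOfW Φ.ext) (Ext.pullbackMapW e₂.proj x) = Ext.mkOfW Φ.ext ↔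
      ∃ g : Hom K B, x = Ext.pushoutMapW g (Ext.mkOfW e₂) :=
  e₂.addW_pullbackMapW_proj_eq_self_iff _ x

/-- **Hain's torsor is free for separated `(K, B)`**: the parameter `x ∈ Ext¹(A, B)` carrying one
three-step structure over `(e₁, e₂)` to another is unique. [cite: Hain2024PeriodsRealBiextensions, §2] -/
theorem Filling.eq_of_splice_of_isSeparated (hsep : IsSeparated K B) (Φ : (splice e₁ e₂).Filling VH)
    {x x' : Ext A B}
    (h : Ext.addW (Ext.mkOfW Φ.ext) (Ext.pullbackMapW e₂.proj x) =
      Ext.addW (Ext.mkOfW Φ.ext) (Ext.pullbackMapW e₂.proj x')) : x = x' :=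
  e₂.eq_of_addW_pullbackMapW_proj_eq (Hom.eq_zero_of_isSeparated hsep) h

end TwoExtension

end MixedHodgeStructure

end Literature.AlgebraicGeometry.Motives

end
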